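import Summits.RiemannHypothesis.RiemannHypothesis.Theorems.SemilocalDeletionToeplitzCombsLinear
import HarnessLib

/-!
# The band-edge floor is ATTAINED up to `O(m⁻³)`: the alternating sine comb

`SemilocalDeletionToeplitzBandEdge.lean` (cc-s2-1 gen18) bounds the cost of deleting a prime `p` on a window with `m` visible powers
from above by `F̂_p(m) = 2·log p·(1 + c_m√p)/(p + 2c_m√p + 1)`, `c_m = cos(π/(m+2))` (the KMS symbol at the last frequency of the
path on `m+1` vertices).  Here is the matching LOWER side, by an explicit vector.  With `θ = π/(m+2)`, `s_i = sin((i+1)θ)`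
(the Perron vector of the path; `s_{m+1} = 0`), `ρ = 1/√p` and

  `X_i = (−1)^i·(s_i + ρ·s_{i+1})`  (`i ≤ m`),   so that the ANTICAUSAL companion of `X` is `T_i = ρ·(−1)^{i+1}·s_{i+1}` (§2),

the zero-diagonal Toeplitz form is computed in CLOSED FORM (§1: `Σ s_i s_{i+1} = cos θ·Σ s_i²`, `Σ s_i² = (m+2)/2`):

  `XᵀA_m(p)X = −F̌_p(m)·|X|²`,   `F̌_p(m) = 2·log p·(1 + c_m√p − ε_m)/(p + 2c_m√p + 1 − ε_m)`,  `ε_m = 2sin²(π/(m+2))/(m+2)`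

(`comb_form_eq`), hence `−λ_min(A_m(p)) ≥ F̌_p(m)`, and with the linear comb half-room law of `SemilocalDeletionToeplitzCombsLinear`
(§3, `semilocalGroundEnergy_erase_le_neg_bandEdgeComb`):

  `λ_min(S∖{p}; m·log p/2 + δ) ≤ −F̌_p(m) + (m+1)·λ_min(S; δ)`   (`Q_S ≥ 0` on the window, `0 < δ`, `2δ < log p`).

`F̌_p(m) ≤ F̂_p(m) < F_p = 2·log p/(√p+1)` and `F̂_p(m) − F̌_p(m) = O(ε_m) = O(m⁻³)` while `F_p − F̂_p(m) ≍ m⁻²`: the finite-window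
single-prime floor `μ_m(p) = −λ_min(A_m(p))` is pinned between two closed forms that agree to third order — the BAND-EDGE LAW
`F_p − μ_m(p) ≍ (log p)·m⁻²` behind the `b⁻²` decay of the single-prime floor deficits (HOME/cc-s2-1/gen17/ANIMAL-SUPREMUM.md §9).
Values `p = 2`: `F̌ = 0.4275, 0.5107, 0.5400, 0.5532, 0.5602` at `m = 1…5` (sharp: `0.4901, 0.5412, 0.5563, 0.5629, 0.5664`;
`F̂ = 0.5361, 0.5545, 0.5621, 0.5660, 0.5682`).

Nothing here bears on RH; these are statements about truncated Weil forms.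
-/

set_option linter.dupNamespace false

noncomputable section

open Complex Filter Set MeasureTheory
open scoped Real Topology ComplexConjugate

namespace Summit.RiemannHypothesis.RiemannHypothesis.Theorems.SemilocalDeletionToeplitzBandEdgeCombs

open Literature.NumberTheory.LFunctions
open Summit.RiemannHypothesis.RiemannHypothesis.Theorems.HandoffSemilocalEnergy
open Summit.RiemannHypothesis.RiemannHypothesis.Theorems.SemilocalDeletionToeplitzFloor
open Summit.RiemannHypothesis.RiemannHypothesis.Theorems.SemilocalDeletionToeplitzCombsLinear

/-! ## §1  Sine sums on the path: `Σ_{i≤m} s_i s_{i+1} = cos θ·Σ_{i≤m} s_i²` and `Σ_{i≤m} s_i² = (m+2)/2` -/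

/-- `sin((m+2)θ) = 0` for `θ = π/(m+2)`. -/
private theorem sin_end (m : ℕ) : Real.sin ((((m + 2 : ℕ) : ℝ)) * (π / (m + 2))) = 0 := by
  have hm : (m : ℝ) + 2 ≠ 0 := by positivity
  rw [show (((m + 2 : ℕ) : ℝ)) * (π / (m + 2)) = π by push_cast; field_simp, Real.sin_pi]

/-- `Σ_{i≤m} sin(iθ)… the lag-one sine sum`: `Σ_{i≤m} sin((i+1)θ)·sin((i+2)θ) = cos θ·Σ_{i≤m} sin²((i+1)θ)` for `θ = π/(m+2)`
(the Perron eigenvalue relation of the path: `sin(iθ) + sin((i+2)θ) = 2cos θ·sin((i+1)θ)`, `sin 0 = sin((m+2)θ) = 0`). -/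
theorem sum_sin_mul_sin_succ (m : ℕ) :
    ∑ i ∈ Finset.range (m + 1), Real.sin (((i : ℝ) + 1) * (π / (m + 2))) * Real.sin (((i : ℝ) + 2) * (π / (m + 2))) =
      Real.cos (π / (m + 2)) * ∑ i ∈ Finset.range (m + 1), Real.sin (((i : ℝ) + 1) * (π / (m + 2))) ^ 2 := by
  set θ := π / (m + 2) with hθ
  set S : ℕ → ℝ := fun i ↦ Real.sin ((i : ℝ) * θ) with hS
  have hS1 : ∀ i : ℕ, Real.sin (((i : ℝ) + 1) * θ) = S (i + 1) := fun i ↦ by simp only [hS]; push_cast; ring_nf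
  have hS2 : ∀ i : ℕ, Real.sin (((i : ℝ) + 2) * θ) = S (i + 2) := fun i ↦ by simp only [hS]; push_cast; ring_nf
  simp only [hS1, hS2]
  have hrec : ∀ i : ℕ, S i + S (i + 2) = 2 * Real.cos θ * S (i + 1) := by
    intro i
    have h := Real.two_mul_sin_mul_cos (((i : ℝ) + 1) * θ) θ
    simp only [hS]; push_cast
    rw [show ((i : ℝ) + 1) * θ - θ = (i : ℝ) * θ by ring, show ((i : ℝ) + 1) * θ + θ = ((i : ℝ) + 2) * θ by ring] at h
    linarith
  have h0 : S 0 = 0 := by simp [hS]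
  have hend : S (m + 2) = 0 := by simpa [hS] using sin_end m
  -- `2cos θ·Σ S(i+1)² = Σ (S i + S(i+2)) S(i+1) = Σ S i S(i+1) + Σ S(i+1) S(i+2)` and both sums equal `Σ_{i≤m} S(i+1)S(i+2)`
  have h1 : ∑ i ∈ Finset.range (m + 1), S i * S (i + 1) = ∑ i ∈ Finset.range (m + 1), S (i + 1) * S (i + 2) := by
    rw [Finset.sum_range_succ' (fun i ↦ S i * S (i + 1)), h0, zero_mul, add_zero, Finset.sum_range_succ, hend, mul_zero,
      add_zero]
  have h2 : 2 * Real.cos θ * ∑ i ∈ Finset.range (m + 1), S (i + 1) ^ 2 =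
      ∑ i ∈ Finset.range (m + 1), S i * S (i + 1) + ∑ i ∈ Finset.range (m + 1), S (i + 1) * S (i + 2) := by
    rw [Finset.mul_sum, ← Finset.sum_add_distrib]
    exact Finset.sum_congr rfl fun i _ ↦ by linear_combination (-(S (i + 1))) * hrec i
  rw [h1] at h2
  linarith

/-- `Σ_{i≤m} sin²((i+1)π/(m+2)) = (m+2)/2` (telescoping `2 sin θ·cos(2kθ) = sin((2k+1)θ) − sin((2k−1)θ)`). -/
theorem sum_sin_sq (m : ℕ) :
    ∑ i ∈ Finset.range (m + 1), Real.sin (((i : ℝ) + 1) * (π / (m + 2))) ^ 2 = ((m : ℝ) + 2) / 2 := by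
  set θ := π / (m + 2) with hθ
  have hm : (0 : ℝ) < m + 2 := by positivity
  have hsin : 0 < Real.sin θ := by
    apply Real.sin_pos_of_pos_of_lt_pi (by positivity)
    rw [hθ, div_lt_iff₀ hm]; nlinarith [Real.pi_pos]
  -- telescoping: `2 sin θ cos(2(i+1)θ) = g(i+1) − g(i)`, `g(i) = sin((2i+1)θ)`
  set g : ℕ → ℝ := fun i ↦ Real.sin ((2 * (i : ℝ) + 1) * θ) with hg
  have htel : ∀ i : ℕ, 2 * Real.sin θ * Real.cos (2 * (((i : ℝ) + 1) * θ)) = g (i + 1) - g i := by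
    intro i
    rw [Real.two_mul_sin_mul_cos]
    simp only [hg]; push_cast
    rw [show θ - 2 * (((i : ℝ) + 1) * θ) = -((2 * (i : ℝ) + 1) * θ) by ring, Real.sin_neg,
      show θ + 2 * (((i : ℝ) + 1) * θ) = (2 * ((i : ℝ) + 1) + 1) * θ by ring]
    ring
  have hgend : g (m + 1) = -Real.sin θ := by
    simp only [hg]; push_cast
    rw [show (2 * ((m : ℝ) + 1) + 1) * θ = 2 * π - θ by rw [hθ]; field_simp; ring, Real.sin_two_pi_sub]
  have hg0 : g 0 = Real.sin θ := by simp [hg]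
  have hcos : ∑ i ∈ Finset.range (m + 1), Real.cos (2 * (((i : ℝ) + 1) * θ)) = -1 := by
    have h := Finset.sum_range_sub g (m + 1)
    rw [hgend, hg0, ← Finset.sum_congr rfl fun i _ ↦ htel i, ← Finset.mul_sum] at h
    nlinarith
  have hsq : ∀ i : ℕ, Real.sin (((i : ℝ) + 1) * θ) ^ 2 = 1 / 2 - Real.cos (2 * (((i : ℝ) + 1) * θ)) / 2 := by
    intro i; rw [Real.sin_sq, Real.cos_sq]; ring
  rw [Finset.sum_congr rfl fun i _ ↦ hsq i, Finset.sum_sub_distrib, ← Finset.sum_div, ← Finset.sum_div, hcos,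
    Finset.sum_const, Finset.card_range, nsmul_eq_mul]
  push_cast; ring


/-- Shifted square sum: `Σ_{i≤m} sin²((i+2)θ) = Σ_{i≤m} sin²((i+1)θ) − sin²θ` (`θ = π/(m+2)`, `sin((m+2)θ) = 0`). -/
theorem sum_sin_sq_shift (m : ℕ) :
    ∑ i ∈ Finset.range (m + 1), Real.sin (((i : ℝ) + 2) * (π / (m + 2))) ^ 2 =
      ∑ i ∈ Finset.range (m + 1), Real.sin (((i : ℝ) + 1) * (π / (m + 2))) ^ 2 - Real.sin (π / (m + 2)) ^ 2 := by
  set θ := π / (m + 2) with hθ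
  set F : ℕ → ℝ := fun i ↦ Real.sin (((i : ℝ) + 1) * θ) ^ 2 with hF
  have h1 : ∑ i ∈ Finset.range (m + 2), F i = ∑ i ∈ Finset.range (m + 1), F (i + 1) + F 0 := Finset.sum_range_succ' F (m + 1)
  have h2 : ∑ i ∈ Finset.range (m + 2), F i = ∑ i ∈ Finset.range (m + 1), F i + F (m + 1) := Finset.sum_range_succ F (m + 1)
  have hend : F (m + 1) = 0 := by
    simp only [hF]; push_cast
    rw [show ((m : ℝ) + 1 + 1) = ((m + 2 : ℕ) : ℝ) by push_cast; ring, sin_end m]; ring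
  have h0 : F 0 = Real.sin θ ^ 2 := by simp [hF]
  have hshift : ∀ i : ℕ, F (i + 1) = Real.sin (((i : ℝ) + 2) * θ) ^ 2 := fun i ↦ by
    simp only [hF]; push_cast; rw [show ((i : ℝ) + 1 + 1) = (i : ℝ) + 2 by ring]
  rw [← Finset.sum_congr rfl fun i _ ↦ hshift i]
  linarith

/-! ## §2  The one-sided lag form as `⟨x, t⟩` for the anticausal companion, and the comb vector -/

/-- **Anticausal companions are unique:** two sequences with `t_m = 0` and `t_i = ρ(t_{i+1} + x_{i+1})` (`i < m`) agree on `{0,…,m}`. -/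
theorem anticausal_unique {ρ : ℝ} {m : ℕ} {x t t' : ℕ → ℝ} (ht : t m = 0) (ht' : t' m = 0)
    (hrec : ∀ i < m, t i = ρ * (t (i + 1) + x (i + 1))) (hrec' : ∀ i < m, t' i = ρ * (t' (i + 1) + x (i + 1))) :
    ∀ i ≤ m, t i = t' i := by
  suffices h : ∀ k ≤ m, t (m - k) = t' (m - k) by
    intro i hi
    have := h (m - i) (by omega)
    rwa [Nat.sub_sub_self hi] at this
  intro k
  induction k with
  | zero => intro; simp [ht, ht']
  | succ k ih =>
    intro hk
    rw [hrec _ (by omega), hrec' _ (by omega), show m - (k + 1) + 1 = m - k by omega, ih (by omega)]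

/-- **The one-sided lag form is `⟨x, t⟩`.** For `x : ℕ → ℝ` vanishing beyond `m` and ANY anticausal companion `t` of `x`
(`t_m = 0`, `t_i = ρ(t_{i+1} + x_{i+1})`): `Σ_{e<m} ρ^{e+1}·Σ_{i≤m} x_i x_{i+e+1} = Σ_{i≤m} x_i t_i`. -/
theorem lagForm_eq_sum_mul_anticausal {ρ : ℝ} {m : ℕ} {x t : ℕ → ℝ} (hx : ∀ j, m < j → x j = 0) (ht : t m = 0)
    (hrec : ∀ i < m, t i = ρ * (t (i + 1) + x (i + 1))) :
    ∑ e ∈ Finset.range m, ρ ^ (e + 1) * ∑ i ∈ Finset.range (m + 1), x i * x (i + (e + 1)) =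
      ∑ i ∈ Finset.range (m + 1), x i * t i := by
  -- the filter sum `T_i = Σ_e ρ^{e+1} x_{i+e+1}` is an anticausal companion, hence equals `t` on `{0,…,m}`
  set T : ℕ → ℝ := fun i ↦ ∑ e ∈ Finset.range m, ρ ^ (e + 1) * x (i + (e + 1)) with hT
  have hTm : T m = 0 := Finset.sum_eq_zero fun e _ ↦ by rw [hx _ (by omega), mul_zero]
  have hTrec : ∀ i < m, T i = ρ * (T (i + 1) + x (i + 1)) := by
    intro i hi
    have hA : ∑ e ∈ Finset.range (m + 1), ρ ^ (e + 1) * x (i + (e + 1)) = T i := by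
      simp only [hT]; rw [Finset.sum_range_succ, hx _ (by omega), mul_zero, add_zero]
    have hB : ∑ e ∈ Finset.range (m + 1), ρ ^ (e + 1) * x (i + (e + 1)) = ρ * (T (i + 1) + x (i + 1)) := by
      simp only [hT]; rw [Finset.sum_range_succ', mul_add, Finset.mul_sum]
      simp only [zero_add, pow_one]
      congr 1
      exact Finset.sum_congr rfl fun e _ ↦ by rw [show i + (e + 1 + 1) = i + 1 + (e + 1) by ring]; ring
    rw [← hA, hB]
  have heq := anticausal_unique hTm ht hTrec hrec
  have hswap : ∑ e ∈ Finset.range m, ρ ^ (e + 1) * ∑ i ∈ Finset.range (m + 1), x i * x (i + (e + 1)) =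
      ∑ i ∈ Finset.range (m + 1), x i * T i := by
    simp only [hT, Finset.mul_sum]
    rw [Finset.sum_comm]
    exact Finset.sum_congr rfl fun i _ ↦ Finset.sum_congr rfl fun e _ ↦ by ring
  rw [hswap]
  exact Finset.sum_congr rfl fun i hi ↦ by rw [heq i (Nat.lt_succ_iff.mp (Finset.mem_range.mp hi))]

variable {p : ℕ}

/-- **The comb vector and its companion.** `θ = π/(m+2)`, `X_i = (−1)^i(sin((i+1)θ) + ρ sin((i+2)θ))` and
`T_i = ρ(−1)^{i+1} sin((i+2)θ)` on `{0,…,m}` (zero beyond): `T` is an anticausal companion of `X` — `T_m = 0` because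
`sin((m+2)θ) = 0`, and `T_i = ρ(T_{i+1} + X_{i+1})` identically. -/
theorem comb_anticausal {ρ θ : ℝ} {m : ℕ} (hθ : θ = π / (m + 2)) {X T : ℕ → ℝ}
    (hX : ∀ i, X i = if i ≤ m then (-1) ^ i * (Real.sin (((i : ℝ) + 1) * θ) + ρ * Real.sin (((i : ℝ) + 2) * θ)) else 0)
    (hT : ∀ i, T i = if i ≤ m then ρ * (-1) ^ (i + 1) * Real.sin (((i : ℝ) + 2) * θ) else 0) :
    T m = 0 ∧ ∀ i < m, T i = ρ * (T (i + 1) + X (i + 1)) := by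
  constructor
  · rw [hT, if_pos le_rfl, show ((m : ℝ) + 2) = ((m + 2 : ℕ) : ℝ) by push_cast; ring, hθ, sin_end m, mul_zero]
  · intro i hi
    rw [hT, if_pos hi.le, hT, if_pos (by omega : i + 1 ≤ m), hX, if_pos (by omega : i + 1 ≤ m)]
    push_cast
    rw [show ((i : ℝ) + 1 + 1) = (i : ℝ) + 2 by ring]
    ring

/-- **Closed forms.** With `N = Σ_{i≤m} sin²((i+1)θ) = (m+2)/2`, `σ = sin θ`, `c = cos θ`:
`Σ_{i≤m} X_i T_i = −ρ·((c + ρ)·N − ρ·σ²)` and `Σ_{i≤m} X_i² = (1 + 2ρc + ρ²)·N − ρ²·σ²`. -/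
theorem comb_sums {ρ θ : ℝ} {m : ℕ} (hθ : θ = π / (m + 2)) {X T : ℕ → ℝ}
    (hX : ∀ i, X i = if i ≤ m then (-1) ^ i * (Real.sin (((i : ℝ) + 1) * θ) + ρ * Real.sin (((i : ℝ) + 2) * θ)) else 0)
    (hT : ∀ i, T i = if i ≤ m then ρ * (-1) ^ (i + 1) * Real.sin (((i : ℝ) + 2) * θ) else 0) :
    ∑ i ∈ Finset.range (m + 1), X i * T i =
        -(ρ * ((Real.cos θ + ρ) * (((m : ℝ) + 2) / 2) - ρ * Real.sin θ ^ 2)) ∧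
      ∑ i ∈ Finset.range (m + 1), X i ^ 2 = (1 + 2 * ρ * Real.cos θ + ρ ^ 2) * (((m : ℝ) + 2) / 2) - ρ ^ 2 * Real.sin θ ^ 2 := by
  have hN := sum_sin_sq m
  have hP := sum_sin_mul_sin_succ m
  have hS := sum_sin_sq_shift m
  rw [← hθ] at hN hP hS
  have hsgn : ∀ i : ℕ, ((-1 : ℝ) ^ i) ^ 2 = 1 := fun i ↦ by rw [← pow_mul, mul_comm, pow_mul, neg_one_sq, one_pow]
  have hmem : ∀ i ∈ Finset.range (m + 1), i ≤ m := fun i hi ↦ Nat.lt_succ_iff.mp (Finset.mem_range.mp hi)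
  constructor
  · have hterm : ∀ i ∈ Finset.range (m + 1), X i * T i =
        -ρ * (Real.sin (((i : ℝ) + 1) * θ) * Real.sin (((i : ℝ) + 2) * θ)) + -ρ ^ 2 * Real.sin (((i : ℝ) + 2) * θ) ^ 2 := by
      intro i hi
      rw [hX, if_pos (hmem i hi), hT, if_pos (hmem i hi)]
      have := hsgn i
      linear_combination (-ρ * (Real.sin (((i : ℝ) + 1) * θ) + ρ * Real.sin (((i : ℝ) + 2) * θ)) *
        Real.sin (((i : ℝ) + 2) * θ)) * this
    rw [Finset.sum_congr rfl hterm, Finset.sum_add_distrib, ← Finset.mul_sum, ← Finset.mul_sum, hP, hS, hN]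
    ring
  · have hterm : ∀ i ∈ Finset.range (m + 1), X i ^ 2 =
        Real.sin (((i : ℝ) + 1) * θ) ^ 2 + 2 * ρ * (Real.sin (((i : ℝ) + 1) * θ) * Real.sin (((i : ℝ) + 2) * θ)) +
          ρ ^ 2 * Real.sin (((i : ℝ) + 2) * θ) ^ 2 := by
      intro i hi
      rw [hX, if_pos (hmem i hi)]
      have := hsgn i
      linear_combination ((Real.sin (((i : ℝ) + 1) * θ) + ρ * Real.sin (((i : ℝ) + 2) * θ)) ^ 2) * this
    rw [Finset.sum_congr rfl hterm, Finset.sum_add_distrib, Finset.sum_add_distrib, ← Finset.mul_sum, ← Finset.mul_sum,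
      hP, hS, hN]
    ring


/-! ## §3  `XᵀA_m(p)X = −F̌_p(m)·|X|²` and the continuum consequence -/

/-- **THE BAND-EDGE COMB.** For every prime `p` and every `m` there is a real vector `X` on `{0,…,m}` (the alternating sine comb
`X_i = (−1)^i(sin((i+1)θ) + sin((i+2)θ)/√p)`, `θ = π/(m+2)`), `X ≠ 0`, on which the zero-diagonal Toeplitz form takes the value
`XᵀA_m(p)X = 2·Σ_{e<m} (log p/√(p^{e+1}))·Σ_i X_i X_{i+e+1} = −F̌_p(m)·|X|²` EXACTLY, with
`F̌_p(m) = 2·log p·(1 + c_m√p − ε_m)/(p + 2c_m√p + 1 − ε_m)`, `c_m = cos(π/(m+2))`, `ε_m = 2sin²(π/(m+2))/(m+2)`.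
Hence `−λ_min(A_m(p)) ≥ F̌_p(m)`: the band-edge floor `F̂_p(m)` (same formula with `ε_m = 0`) is attained up to `O(m⁻³)`. -/
theorem exists_bandEdge_comb (hp : p.Prime) (m : ℕ) :
    ∃ X : ℕ → ℝ, (∀ j, m < j → X j = 0) ∧ 0 < ∑ i ∈ Finset.range (m + 1), X i ^ 2 ∧
      2 * ∑ e ∈ Finset.range m, Real.log p / Real.sqrt ((p : ℝ) ^ (e + 1)) *
          ∑ i ∈ Finset.range (m + 1), X i * X (i + (e + 1)) =
        -(2 * Real.log p * (1 + Real.cos (π / (m + 2)) * Real.sqrt p - 2 * Real.sin (π / (m + 2)) ^ 2 / (m + 2)) /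
            (p + 2 * Real.cos (π / (m + 2)) * Real.sqrt p + 1 - 2 * Real.sin (π / (m + 2)) ^ 2 / (m + 2))) *
          ∑ i ∈ Finset.range (m + 1), X i ^ 2 := by
  have hp0 : (0 : ℝ) < p := by exact_mod_cast hp.pos
  have hp1 : (1 : ℝ) < p := by exact_mod_cast hp.one_lt
  have hs1 : 1 < Real.sqrt p := by rw [show (1 : ℝ) = Real.sqrt 1 by simp]; exact Real.sqrt_lt_sqrt zero_le_one hp1
  have hs0 : 0 < Real.sqrt p := by linarith
  set θ := π / ((m : ℝ) + 2) with hθ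
  set ρ : ℝ := (Real.sqrt p)⁻¹ with hρdef
  set X : ℕ → ℝ := fun i ↦
    if i ≤ m then (-1) ^ i * (Real.sin (((i : ℝ) + 1) * θ) + ρ * Real.sin (((i : ℝ) + 2) * θ)) else 0 with hXdef
  set T : ℕ → ℝ := fun i ↦ if i ≤ m then ρ * (-1) ^ (i + 1) * Real.sin (((i : ℝ) + 2) * θ) else 0 with hTdef
  have hX : ∀ j, m < j → X j = 0 := fun j hj ↦ by simp only [hXdef]; rw [if_neg (by omega)]
  obtain ⟨hTm, hTrec⟩ := comb_anticausal hθ (X := X) (T := T) (fun i ↦ rfl) (fun i ↦ rfl)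
  obtain ⟨hXT, hXX⟩ := comb_sums hθ (X := X) (T := T) (fun i ↦ rfl) (fun i ↦ rfl)
  have hform := lagForm_eq_sum_mul_anticausal hX hTm hTrec
  -- the weights `log p/√(p^{e+1}) = log p·ρ^{e+1}`
  have hw : ∀ e : ℕ, Real.log p / Real.sqrt ((p : ℝ) ^ (e + 1)) = Real.log p * ρ ^ (e + 1) := by
    intro e
    have : Real.sqrt ((p : ℝ) ^ (e + 1)) = Real.sqrt p ^ (e + 1) := by
      rw [show ((p : ℝ) ^ (e + 1)) = (Real.sqrt p ^ (e + 1)) ^ 2 by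
        rw [← pow_mul, mul_comm, pow_mul, Real.sq_sqrt hp0.le], Real.sqrt_sq (pow_nonneg hs0.le _)]
    rw [this, hρdef, inv_pow, div_eq_mul_inv]
  have hA0 : ∑ e ∈ Finset.range m, Real.log p / Real.sqrt ((p : ℝ) ^ (e + 1)) *
        ∑ i ∈ Finset.range (m + 1), X i * X (i + (e + 1)) =
      Real.log p * ∑ e ∈ Finset.range m, ρ ^ (e + 1) * ∑ i ∈ Finset.range (m + 1), X i * X (i + (e + 1)) := by
    rw [Finset.mul_sum]; exact Finset.sum_congr rfl fun e _ ↦ by rw [hw]; ring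
  have hA : 2 * ∑ e ∈ Finset.range m, Real.log p / Real.sqrt ((p : ℝ) ^ (e + 1)) *
        ∑ i ∈ Finset.range (m + 1), X i * X (i + (e + 1)) = 2 * Real.log p * ∑ i ∈ Finset.range (m + 1), X i * T i := by
    rw [hA0, hform]; ring
  -- positivity of `|X|²`
  set N : ℝ := ((m : ℝ) + 2) / 2 with hN
  set σ := Real.sin θ with hσ
  set c := Real.cos θ with hc
  have hσ1 : σ ^ 2 ≤ 1 := Real.sin_sq_le_one θ
  have hσ0 : 0 < σ := by
    have hm : (0 : ℝ) < m + 2 := by positivity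
    apply Real.sin_pos_of_pos_of_lt_pi (by positivity)
    rw [hθ, div_lt_iff₀ hm]; nlinarith [Real.pi_pos]
  have hc0 : 0 ≤ c := by
    have hm : (2 : ℝ) ≤ m + 2 := by linarith [(Nat.cast_nonneg m : (0 : ℝ) ≤ m)]
    refine Real.cos_nonneg_of_neg_pi_div_two_le_of_le ?_ (div_le_div_of_nonneg_left Real.pi_pos.le (by norm_num) hm)
    have : 0 ≤ π / (m + 2) := by positivity
    linarith [Real.pi_pos]
  have hρ0 : 0 < ρ := inv_pos.mpr hs0
  have hρ1 : ρ < 1 := inv_lt_one_of_one_lt₀ hs1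
  have hN1 : 1 ≤ N := by rw [hN]; linarith [(Nat.cast_nonneg m : (0 : ℝ) ≤ m)]
  have hpos : 0 < ∑ i ∈ Finset.range (m + 1), X i ^ 2 := by
    rw [hXX]
    have h1 : 0 ≤ 2 * ρ * c * N := by positivity
    have h2 : ρ ^ 2 * σ ^ 2 < 1 * N := by
      rw [one_mul]
      calc ρ ^ 2 * σ ^ 2 < 1 * σ ^ 2 := by
            apply mul_lt_mul_of_pos_right _ (by positivity); nlinarith
        _ ≤ N := by linarith
    nlinarith [sq_nonneg ρ]
  refine ⟨X, hX, hpos, ?_⟩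
  rw [hA, hXT, hXX]
  -- the closed forms agree: pass to `r = √p`, `p = r²`
  set L := Real.log (p : ℝ) with hL
  have hsq : Real.sqrt p ^ 2 = p := Real.sq_sqrt hp0.le
  set r := Real.sqrt (p : ℝ) with hr
  have hpr : (p : ℝ) = r ^ 2 := hsq.symm
  have hr0 : r ≠ 0 := hs0.ne'
  have hm2 : ((m : ℝ) + 2) ≠ 0 := by positivity
  have hm0 : (0 : ℝ) ≤ m := Nat.cast_nonneg m
  have hB : (p : ℝ) + 2 * c * r + 1 - 2 * σ ^ 2 / ((m : ℝ) + 2) ≠ 0 := by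
    have h1 : 2 * σ ^ 2 / ((m : ℝ) + 2) ≤ 1 := by rw [div_le_one (by positivity)]; linarith
    have h2 : 0 ≤ 2 * c * r := by positivity
    linarith
  rw [show ∀ A B Q : ℝ, -(A / B) * Q = -(A * Q) / B from fun A B Q ↦ by ring, eq_div_iff hB, hpr, hρdef, hN]
  field_simp
  ring


/-- **THE BAND-EDGE FLOOR IS ATTAINED (continuum form).** `p ∈ S` prime, `0 < δ`, `2δ < log p`, and `Q_S ≥ 0` on the window
`C(m·log p/2 + δ)` (e.g. `S ⊆` primes `≤ e^{2c}` under the proved rungs, or any `S` under RH).  Then the comb of `m+1` blocks with the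
alternating sine amplitudes of `exists_bandEdge_comb` gives
`λ_min(S∖{p}; m·log p/2 + δ) ≤ −F̌_p(m) + (m+1)·λ_min(S; δ)`:
together with `SemilocalDeletionToeplitzBandEdge.semilocalGroundEnergy_erase_ge_bandEdge` the single-prime deletion cost on a window with
`m` visible powers is pinned between `−F̂_p(m)` and `−F̌_p(m)` up to the undeleted comb energy `(m+1)·λ_min(S; δ)`. -/
theorem semilocalGroundEnergy_erase_le_neg_bandEdgeComb {S : Finset ℕ} (hp : p.Prime) (hpS : p ∈ S) {m : ℕ} {δ : ℝ}
    (hδ0 : 0 < δ) (hδ : 2 * δ < Real.log p) (hpos : WeilSemilocalPositivityOn S (m * Real.log p / 2 + δ)) :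
    semilocalGroundEnergy (S.erase p) (fun _ ↦ True) (m * Real.log p / 2 + δ) ≤
      -(2 * Real.log p * (1 + Real.cos (π / (m + 2)) * Real.sqrt p - 2 * Real.sin (π / (m + 2)) ^ 2 / (m + 2)) /
          (p + 2 * Real.cos (π / (m + 2)) * Real.sqrt p + 1 - 2 * Real.sin (π / (m + 2)) ^ 2 / (m + 2))) +
        (m + 1) * semilocalGroundEnergy S (fun _ ↦ True) δ := by
  obtain ⟨X, hX, hX0, hform⟩ := exists_bandEdge_comb hp m
  have h := semilocalGroundEnergy_erase_top_le_comb_linear hp hpS hδ0 hδ hpos hX hX0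
  rw [hform] at h
  refine le_of_mul_le_mul_right ?_ hX0
  linarith

end Summit.RiemannHypothesis.RiemannHypothesis.Theorems.SemilocalDeletionToeplitzBandEdgeCombs

end
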